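import Summits.NavierStokesRegularity.NavierStokesRegularity.Theses.HardyPointSink
import Literature.Analysis.FluidPDE.AncientL3BackwardLiouvilleHolds
import Summits.NavierStokesRegularity.NavierStokesRegularity.Theorems.HardyPointSinkNoHardyTypeIAncientWeakL3Liouville

/-!
# Route HardyPointSink — crux `NoHardyTypeIAncient` (stmt-NavierStokesRegularity-7980), line `birth`:
# certificate — the Liouville half in `L³`, unconditional

Summit-side proof file (certificate sub-goal `hardyPointSink_cert_L3seqLiouville` of the registered
skeleton `Cruxes/NoHardyTypeIAncient/Lines/birth.lean`, lead c4). A Hardy-bounded bounded ancient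
mild solution of Navier–Stokes (`ν = 1`, duality form) with a.e.-strongly measurable slices, jointly
a.e.-strongly measurable on the slab `(−∞, 0) × ℝ³`, whose slices are bounded in `L³` along negative
times `τ_k → −∞`, vanishes a.e. on a.e. slice. Albritton–Barker 2019, Thm 1.2 is a tree THEOREM
(`Literature.Analysis.FluidPDE.AlbrittonBarker2019_liouville_L3_backward_holds`) over the bounded
Oseen integral-equation class; the duality-form solution `u` is carried into that class by the
continuous Oseen representative `U` of the line (`stub_hardyOseenWindow` with
`stub_hardyDriftConstant` on windows, `stub_oseenAncientGluing` across windows): `U` is equal to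
`u` a.e. on a.e. slice and up to a spatial constant on every slice; the Hardy bound passes to every
slice of `U` (`hardyPointSink_hardyEverySlice`); the `L³` bound at `τ_k` is a weak-`L³` bound by
Chebyshev–Markov, which pins the slice constant at `τ_k` to `0` (`stub_weakL3Pinning`), so
`‖U(τ_k)‖₃ = ‖u(τ_k)‖₃ ≤ M`; Thm 1.2 gives `U ≡ 0`; hence `u(t) = 0` a.e. for a.e. `t < 0`.

## References

* D. Albritton, T. Barker, J. Math. Fluid Mech. 21 (2019) no. 43 = arXiv:1811.00502, Thm 1.2
  (arXiv p. 4; proof §4 p. 9).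
* G. Koch, N. Nadirashvili, G. Seregin, V. Šverák, Acta Math. 203 (2009), §4 (i).
-/

noncomputable section

set_option linter.dupNamespace false

open MeasureTheory Set Function Filter TopologicalSpace
open scoped ENNReal NNReal Topology

namespace Summit.NavierStokesRegularity.NavierStokesRegularity.Theorems

/-- **Chebyshev–Markov in `L³`: an `L³` bound is a weak-`L³` bound.** If `‖f‖_{L³} ≤ M` then
`s³ · vol{x : s < |f(x)|} ≤ M³` for every `s > 0`. [folklore] -/
theorem hardyPointSink_weakL3_of_eLpNorm_three
    (f : EuclideanSpace ℝ (Fin 3) → EuclideanSpace ℝ (Fin 3)) (M : ℝ≥0∞)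
    (hf : AEStronglyMeasurable f volume) (hM : eLpNorm f 3 volume ≤ M) :
    ∀ s : ℝ, 0 < s →
      ENNReal.ofReal s ^ 3 * volume {x : EuclideanSpace ℝ (Fin 3) | s < ‖f x‖} ≤ M ^ 3 := by
  intro s _
  have h := mul_meas_ge_le_pow_eLpNorm' volume (p := (3 : ℝ≥0∞)) (by norm_num) (by norm_num) hf
    (ENNReal.ofReal s)
  have h3 : (3 : ℝ≥0∞).toReal = ((3 : ℕ) : ℝ) := by norm_num
  rw [h3, ENNReal.rpow_natCast, ENNReal.rpow_natCast] at h
  calc ENNReal.ofReal s ^ 3 * volume {x : EuclideanSpace ℝ (Fin 3) | s < ‖f x‖}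
      ≤ ENNReal.ofReal s ^ 3 * volume {x : EuclideanSpace ℝ (Fin 3) | ENNReal.ofReal s ≤ ‖f x‖ₑ} := by
        refine mul_le_mul_right (measure_mono fun x hx => ?_) _
        simp only [mem_setOf_eq] at hx ⊢
        rw [← ofReal_norm]
        exact ENNReal.ofReal_le_ofReal hx.le
    _ ≤ eLpNorm f 3 volume ^ 3 := h
    _ ≤ M ^ 3 := by gcongr

/-- **Certificate `hardyPointSink_cert_L3seqLiouville` (the Liouville half of line `birth` in `L³`,
UNCONDITIONAL).** A bounded ancient mild solution `u` of Navier–Stokes (`ν = 1`, duality form) with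
a.e.-strongly measurable slices, jointly a.e.-strongly measurable on `(−∞, 0) × ℝ³`, with
`∫ |u(t)|²/|x − x₀| ≤ K` for every centre `x₀` at a.e. `t < 0`, and with `‖u(τ_k)‖_{L³} ≤ M < ∞`
along negative times `τ_k → −∞`, satisfies `u(t) = 0` a.e. for a.e. `t < 0`. Proof: the continuous
bounded ancient Oseen-mild representative `U` (`stub_hardyOseenWindow`, `stub_hardyDriftConstant`,
`stub_oseenAncientGluing`), Hardy on every slice of `U` (`hardyPointSink_hardyEverySlice`), the
`L³` bound at `τ_k` read as a weak-`L³` bound (Chebyshev–Markov) pins the slice constant to `0`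
(`stub_weakL3Pinning`), so `‖U(τ_k)‖₃ ≤ M`, and Albritton–Barker 2019 Thm 1.2, a tree theorem
(`AlbrittonBarker2019_liouville_L3_backward_holds`), gives `U ≡ 0`.
[cite: AlbrittonBarker2019, Thm 1.2 (arXiv:1811.00502 p. 4)] -/
theorem hardyPointSink_cert_L3seqLiouville :
    ∀ (u : ℝ → EuclideanSpace ℝ (Fin 3) → EuclideanSpace ℝ (Fin 3)),
      (∀ t < 0, AEStronglyMeasurable (u t) volume) →
      AEStronglyMeasurable (uncurry u)
        (volume.restrict (Iio (0 : ℝ) ×ˢ (univ : Set (EuclideanSpace ℝ (Fin 3))))) →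
      Literature.Analysis.FluidPDE.IsBoundedAncientMildSolution 1 u →
      (∃ K : ℝ≥0, ∀ x₀ : EuclideanSpace ℝ (Fin 3), ∀ᵐ t ∂(volume.restrict (Iio (0 : ℝ))),
        ∫⁻ x, ‖u t x‖ₑ ^ 2 / ‖x - x₀‖ₑ ≤ K) →
      (∃ (τ : ℕ → ℝ) (M : ℝ≥0∞), M < ⊤ ∧ Tendsto τ atTop atBot ∧ (∀ k, τ k < 0) ∧
        ∀ k, eLpNorm (u (τ k)) 3 volume ≤ M) →
      ∀ᵐ t ∂(volume.restrict (Iio (0 : ℝ))), u t =ᵐ[volume] 0 := by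
  intro u hmeas hjoint hu hH hL3
  obtain ⟨K, hK⟩ := hH
  obtain ⟨τ, M, hM, hτ, hτneg, hbd⟩ := hL3
  -- the ancient Oseen-mild representative
  obtain ⟨U, hUcont, ⟨C, hUC⟩, hUdiv, hUmild, hUae, hUall⟩ :=
    stub_oseenAncientGluing u hmeas hu
      (stub_hardyOseenWindow stub_hardyDriftConstant u hmeas hjoint hu ⟨K, hK⟩)
  -- Hardy bound on every slice of `U`, every centre
  have hHU : ∀ t < 0, ∀ x₀ : EuclideanSpace ℝ (Fin 3), ∫⁻ x, ‖U t x‖ₑ ^ 2 / ‖x - x₀‖ₑ ≤ K :=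
    hardyPointSink_hardyEverySlice u U K hUcont hUae hK
  -- slices of `U` are continuous, hence measurable
  have hUsl : ∀ t < 0, Continuous (U t) := by
    intro t ht
    have h1 : ContinuousOn (fun x : EuclideanSpace ℝ (Fin 3) => ((t, x) : ℝ × EuclideanSpace ℝ (Fin 3)))
        univ := (Continuous.prodMk_right t).continuousOn
    have h2 : ContinuousOn (uncurry U ∘ fun x : EuclideanSpace ℝ (Fin 3) =>
        ((t, x) : ℝ × EuclideanSpace ℝ (Fin 3))) univ :=
      hUcont.comp h1 (fun x _ => ⟨ht, mem_univ x⟩)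
    exact continuousOn_univ.1 h2
  -- pinning: `u (τ k) = U (τ k)` a.e., the `L³` bound being a weak-`L³` bound
  have haek : ∀ k, u (τ k) =ᵐ[volume] U (τ k) := by
    intro k
    obtain ⟨c, hc⟩ := hUall (τ k) (hτneg k)
    have hH0 : (∫⁻ x, ‖U (τ k) x‖ₑ ^ 2 / ‖x‖ₑ) < ⊤ := by
      have h := hHU (τ k) (hτneg k) 0
      simp only [sub_zero] at h
      exact lt_of_le_of_lt h ENNReal.coe_lt_top
    have hc0 : c = 0 :=
      stub_weakL3Pinning (u (τ k)) (U (τ k)) c (M ^ 3) C (ENNReal.pow_lt_top hM)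
        (hUsl (τ k) (hτneg k)).aestronglyMeasurable (fun x => hUC (τ k) (hτneg k) x) hH0 hc
        (hardyPointSink_weakL3_of_eLpNorm_three (u (τ k)) M (hmeas (τ k) (hτneg k)) (hbd k))
    simpa [hc0] using hc
  -- the `L³` bound transfers to `U (τ k)`
  have hbdU : ∀ k, eLpNorm (U (τ k)) 3 volume ≤ M := fun k =>
    (eLpNorm_congr_ae (haek k)).symm.le.trans (hbd k)
  -- Albritton–Barker 2019, Thm 1.2 (a tree theorem) on the representative
  have hU0 : ∀ t < 0, ∀ x, U t x = 0 :=
    Literature.Analysis.FluidPDE.AlbrittonBarker2019_liouville_L3_backward_holds hUcont ⟨C, hUC⟩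
      hUdiv hUmild ⟨τ, M, hM, hτ, hτneg, hbdU⟩
  -- hence `u = 0` a.e. on a.e. slice
  filter_upwards [hUae, ae_restrict_mem measurableSet_Iio] with t ht htneg
  filter_upwards [ht] with x hx
  rw [hx, hU0 t htneg x]
  rfl

end Summit.NavierStokesRegularity.NavierStokesRegularity.Theorems

end
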